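import Summits.CriticalPhenomena.PercolationContinuityZ3.Theorems.PercAnnulusCrossingIICTwoPointLower
import HarnessLib

/-!
# The two-point function of Kesten's IIC at one scale: `c·π(‖z‖) ≤ ν(0 ↔ z) ≤ C·π(‖z‖)` on `ℤ^d` (lane RSW3, p1 gen 19)

builds on p205010 (kernel theorem, internal audit signed; external expert review pending) — NOT used in this file (the hypotheses are
(A2)□ / `CU⁺_l` / UAD at `p_c(ℤ^d)`; only `p_c(ℤ^d) > 0` is used).

RSW3 lane (LANE 3 `prim-rsw3`), seat `prim-rsw3-p1` (gen 19).  Helper file (`--supports stmt-CriticalPhenomena-4575`);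
no definitions, no sorries.  Memo `run/shared/lean/prim/rsw3/P1-QM.md` §32 (item §31.8 (f)).

Gen 7 (`…IICTwoPointUpper`): `ν(0 ↔ z) ≤ C · π_{p_c}(⌊(n−1)/2⌋)` for `‖z‖_∞ = n ≥ 7` under (A2)□.  Gen 18 (3) (`…IICTwoPointLower`):
`c · π_{p_c}(n) ≤ ν(0 ↔ z)` for `n ≥ n₀` under (A2)□(s,L) + `CU⁺_l` + UAD.  With p2's one-arm ratio bound `π(j) ≤ B π(n)` (`j ≤ n ≤ 8j`,
(A2)□) the two scales coincide:

* **`exists_iicMeasure_real_openConn_two_sided_criticalProbI`** — (A2)□(s,L) + `CU⁺_l(c_U)` + UAD at `p_c(ℤ^d)`, `d ≥ 2`: there are `n₀`, `c, C > 0`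
  with **`c·π_{p_c}(n) ≤ ν(0 ↔ z) ≤ C·π_{p_c}(n)` for every IIC measure `ν` and every `‖z‖_∞ = n ≥ n₀`** — KESTEN'S `ν(0 ↔ z) ≍ π(‖z‖)`
  ON `ℤ^d`, AT THE SAME SCALE, uniformly in `ν`;
* `exists_iicMeasure_real_openConn_two_sided_criticalProbI_of_robustCondAnnulusUniq` — the same from `CU⁺_l + UAD` alone (`CU⁺_l ⇒ (A2)□(l,l²)`);
* **`exists_iicMeasure_real_openConn_two_sided_all_criticalProbI`** — for a given IIC measure `ν`: `c_ν·π(‖z‖_∞) ≤ ν(0 ↔ z) ≤ C_ν·π(‖z‖_∞)` for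
  ALL sites `z`.
References: H. Kesten, Probab. Theory Relat. Fields 73 (1986), Thm. (8) (planar `ν(0 ↔ z) ≍ π(‖z‖)`); D. Basu, A. Sapozhnikov, ECP 22 (2017).
-/

noncomputable section

namespace Summit.CriticalPhenomena.PercolationContinuityZ3.Theorems.Crossing

open MeasureTheory Filter Topology Literature.Probability.Percolation Literature.Probability.LatticeModels
open Literature.Probability.Percolation.DCT16
open Summit.CriticalPhenomena.PercolationContinuityZ3.Theorems.SurfaceTension

variable {d : ℕ}

/-- **THE TWO-POINT FUNCTION OF KESTEN'S IIC IS COMPARABLE TO THE ONE-ARM PROBABILITY AT THE SAME SCALE, ON `ℤ^d`** (`p_c(ℤ^d)`, `d ≥ 2`;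
(A2)□ at aspect `(s,L)`, `2 ≤ s ≤ L`, `ϰ > 0`; `CU⁺_l(c_U)`, `l ≥ 2`, `c_U > 0`; UAD): there are `n₀ ≥ 1` and `c, C > 0` such that for every finite
measure `ν` with Kesten's IIC limit property and every site `z` with `‖z‖_∞ = n ≥ n₀`:
**`c · π_{p_c}(n) ≤ ν(0 ↔ z) ≤ C · π_{p_c}(n)`**. [cite: Kesten1986, Thm. (8)] [cite: BasuSapozhnikov2017ECP, Thm. 1.1] -/
theorem exists_iicMeasure_real_openConn_two_sided_criticalProbI (hd : 2 ≤ d) {s L : ℕ} (hs : 2 ≤ s) (hsL : s ≤ L) {ϰ : ℝ} (hϰ : 0 < ϰ)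
    (hA2 : SetToSetQuasiMultAspectAt d (criticalProbI d) s L ϰ) {l : ℕ} (hl : 2 ≤ l) {cU : ℝ} (hcU : 0 < cU)
    (hCU : ∀ a : ℕ, 1 ≤ a → ∀ E : Set (BondConfig (Site d)), IsUpperSet E → MeasurableSet E →
      cU * (bondPercolation (zdGraph d) (criticalProbI d)).real E ≤ (bondPercolation (zdGraph d) (criticalProbI d)).real (E ∩
        {ω : BondConfig (Site d) | ∀ t ∈ innerBoundary (zdGraph d) (box d a), ∀ s ∈ innerBoundary (zdGraph d) (box d (l * a)),
        ∀ t' ∈ innerBoundary (zdGraph d) (box d a), ∀ s' ∈ innerBoundary (zdGraph d) (box d (l * a)),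
        ω ∈ openConnIn (↑((box d (l * a) \ box d a) ∪ innerBoundary (zdGraph d) (box d a)) : Set (Site d)) t s →
        ω ∈ openConnIn (↑((box d (l * a) \ box d a) ∪ innerBoundary (zdGraph d) (box d a)) : Set (Site d)) t' s' →
        ω ∈ openConnIn (↑((box d (l * a) \ box d a) ∪ innerBoundary (zdGraph d) (box d a)) : Set (Site d)) s s'}))
    (hUAD : ∀ ε : ℝ, 0 < ε → ∃ K₀ : ℕ, ∀ m : ℕ, 1 ≤ m → ∀ N : ℕ, K₀ * m ≤ N →
      (bondPercolation (zdGraph d) (criticalProbI d)).real (boxCrossing d m N) ≤ ε) :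
    ∃ (n₀ : ℕ) (c C : ℝ), 1 ≤ n₀ ∧ 0 < c ∧ 0 < C ∧ ∀ (ν : Measure (BondConfig (Site d))) [IsFiniteMeasure ν],
      (∀ (F : Finset (Sym2 (Site d))) (E : Set (BondConfig (Site d))), MeasurableSet E → DeterminedBy E ↑F →
        Tendsto (fun n : ℕ => (bondPercolation (zdGraph d) (criticalProbI d)).real (E ∩ siteToBoundary d n) /
          oneArmProb d (criticalProbI d) n) atTop (𝓝 (ν.real E))) →
      ∀ (n : ℕ) (z : Site d), n₀ ≤ n → z ∈ sphere d n →
        c * oneArmProb d (criticalProbI d) n ≤ ν.real (openConn 0 z) ∧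
          ν.real (openConn 0 z) ≤ C * oneArmProb d (criticalProbI d) n := by
  obtain ⟨n₀, c, hn₀, hc, hlow⟩ := exists_le_iicMeasure_real_openConn_criticalProbI hd hs hsL hϰ hA2 hl hcU hCU hUAD
  obtain ⟨C, hC, hup⟩ := iicMeasure_real_openConn_le_criticalProbI hd hs hsL hϰ hA2
  obtain ⟨B, hB, hR⟩ := Rsw3.exists_oneArmProb_ratio_of_setToSetQuasiMultAspectAt hd hs hsL hϰ hA2
  refine ⟨max n₀ 7, c, C * B, le_trans hn₀ (le_max_left _ _), hc, by positivity, fun ν _ hν n z hn hz => ⟨?_, ?_⟩⟩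
  · exact hlow ν hν n z (le_trans (le_max_left _ _) hn) hz
  · have hn7 : 7 ≤ n := le_trans (le_max_right _ _) hn
    have hratio : oneArmProb d (criticalProbI d) ((n - 1) / 2) ≤ B * oneArmProb d (criticalProbI d) n :=
      hR ((n - 1) / 2) n (by omega) (by omega) (by omega)
    calc ν.real (openConn 0 z) ≤ C * oneArmProb d (criticalProbI d) ((n - 1) / 2) := hup ν hν n z hn7 hz
      _ ≤ C * (B * oneArmProb d (criticalProbI d) n) := mul_le_mul_of_nonneg_left hratio hC.le
      _ = C * B * oneArmProb d (criticalProbI d) n := by ring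

/-- **THE SAME FROM `CU⁺_l + UAD` ALONE** (`p_c(ℤ^d)`, `d ≥ 2`; `CU⁺_l(c_U)`, `l ≥ 2`, `c_U > 0`; UAD): robust conditional annulus-uniqueness
gives (A2)□ at aspect `(l, l²)` (gen 17), so **`c·π_{p_c}(n) ≤ ν(0 ↔ z) ≤ C·π_{p_c}(n)`** for all IIC measures `ν` and `‖z‖_∞ = n ≥ n₀`.
[cite: Kesten1986, Thm. (8)] -/
theorem exists_iicMeasure_real_openConn_two_sided_criticalProbI_of_robustCondAnnulusUniq (hd : 2 ≤ d) {l : ℕ} (hl : 2 ≤ l) {cU : ℝ}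
    (hcU : 0 < cU)
    (hCU : ∀ a : ℕ, 1 ≤ a → ∀ E : Set (BondConfig (Site d)), IsUpperSet E → MeasurableSet E →
      cU * (bondPercolation (zdGraph d) (criticalProbI d)).real E ≤ (bondPercolation (zdGraph d) (criticalProbI d)).real (E ∩
        {ω : BondConfig (Site d) | ∀ t ∈ innerBoundary (zdGraph d) (box d a), ∀ s ∈ innerBoundary (zdGraph d) (box d (l * a)),
        ∀ t' ∈ innerBoundary (zdGraph d) (box d a), ∀ s' ∈ innerBoundary (zdGraph d) (box d (l * a)),
        ω ∈ openConnIn (↑((box d (l * a) \ box d a) ∪ innerBoundary (zdGraph d) (box d a)) : Set (Site d)) t s →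
        ω ∈ openConnIn (↑((box d (l * a) \ box d a) ∪ innerBoundary (zdGraph d) (box d a)) : Set (Site d)) t' s' →
        ω ∈ openConnIn (↑((box d (l * a) \ box d a) ∪ innerBoundary (zdGraph d) (box d a)) : Set (Site d)) s s'}))
    (hUAD : ∀ ε : ℝ, 0 < ε → ∃ K₀ : ℕ, ∀ m : ℕ, 1 ≤ m → ∀ N : ℕ, K₀ * m ≤ N →
      (bondPercolation (zdGraph d) (criticalProbI d)).real (boxCrossing d m N) ≤ ε) :
    ∃ (n₀ : ℕ) (c C : ℝ), 1 ≤ n₀ ∧ 0 < c ∧ 0 < C ∧ ∀ (ν : Measure (BondConfig (Site d))) [IsFiniteMeasure ν],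
      (∀ (F : Finset (Sym2 (Site d))) (E : Set (BondConfig (Site d))), MeasurableSet E → DeterminedBy E ↑F →
        Tendsto (fun n : ℕ => (bondPercolation (zdGraph d) (criticalProbI d)).real (E ∩ siteToBoundary d n) /
          oneArmProb d (criticalProbI d) n) atTop (𝓝 (ν.real E))) →
      ∀ (n : ℕ) (z : Site d), n₀ ≤ n → z ∈ sphere d n →
        c * oneArmProb d (criticalProbI d) n ≤ ν.real (openConn 0 z) ∧
          ν.real (openConn 0 z) ≤ C * oneArmProb d (criticalProbI d) n := by
  have hA2 := setToSetQuasiMultAspectAt_of_robustCondAnnulusUniq hd hl hcU.le hCU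
  have hd0 : (0 : ℝ) < d := by exact_mod_cast (lt_of_lt_of_le (by norm_num) hd)
  exact exists_iicMeasure_real_openConn_two_sided_criticalProbI hd hl (by nlinarith) (by positivity) hA2 hl hcU hCU hUAD

/-- **FOR A GIVEN IIC MEASURE THE SANDWICH HOLDS AT EVERY SITE** (`p_c(ℤ^d)`, `d ≥ 2`; (A2)□(s,L) + `CU⁺_l` + UAD): for every finite measure `ν`
with Kesten's IIC limit property there are `c_ν, C_ν > 0` with **`c_ν·π_{p_c}(‖z‖_∞) ≤ ν(0 ↔ z) ≤ C_ν·π_{p_c}(‖z‖_∞)` for ALL sites `z`**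
(small sites: `ν(0 ↔ z) ≤ ν(univ)` and `π(‖z‖) ≥ π(n₀) > 0`). [cite: Kesten1986, Thm. (8)] -/
theorem exists_iicMeasure_real_openConn_two_sided_all_criticalProbI (hd : 2 ≤ d) {s L : ℕ} (hs : 2 ≤ s) (hsL : s ≤ L) {ϰ : ℝ}
    (hϰ : 0 < ϰ) (hA2 : SetToSetQuasiMultAspectAt d (criticalProbI d) s L ϰ) {l : ℕ} (hl : 2 ≤ l) {cU : ℝ} (hcU : 0 < cU)
    (hCU : ∀ a : ℕ, 1 ≤ a → ∀ E : Set (BondConfig (Site d)), IsUpperSet E → MeasurableSet E →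
      cU * (bondPercolation (zdGraph d) (criticalProbI d)).real E ≤ (bondPercolation (zdGraph d) (criticalProbI d)).real (E ∩
        {ω : BondConfig (Site d) | ∀ t ∈ innerBoundary (zdGraph d) (box d a), ∀ s ∈ innerBoundary (zdGraph d) (box d (l * a)),
        ∀ t' ∈ innerBoundary (zdGraph d) (box d a), ∀ s' ∈ innerBoundary (zdGraph d) (box d (l * a)),
        ω ∈ openConnIn (↑((box d (l * a) \ box d a) ∪ innerBoundary (zdGraph d) (box d a)) : Set (Site d)) t s →
        ω ∈ openConnIn (↑((box d (l * a) \ box d a) ∪ innerBoundary (zdGraph d) (box d a)) : Set (Site d)) t' s' →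
        ω ∈ openConnIn (↑((box d (l * a) \ box d a) ∪ innerBoundary (zdGraph d) (box d a)) : Set (Site d)) s s'}))
    (hUAD : ∀ ε : ℝ, 0 < ε → ∃ K₀ : ℕ, ∀ m : ℕ, 1 ≤ m → ∀ N : ℕ, K₀ * m ≤ N →
      (bondPercolation (zdGraph d) (criticalProbI d)).real (boxCrossing d m N) ≤ ε)
    {ν : Measure (BondConfig (Site d))} [IsFiniteMeasure ν]
    (hν : ∀ (F : Finset (Sym2 (Site d))) (E : Set (BondConfig (Site d))), MeasurableSet E → DeterminedBy E ↑F →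
      Tendsto (fun n : ℕ => (bondPercolation (zdGraph d) (criticalProbI d)).real (E ∩ siteToBoundary d n) /
        oneArmProb d (criticalProbI d) n) atTop (𝓝 (ν.real E))) :
    ∃ c C : ℝ, 0 < c ∧ 0 < C ∧ ∀ z : Site d,
      c * oneArmProb d (criticalProbI d) (Site.supNorm z) ≤ ν.real (openConn 0 z) ∧
        ν.real (openConn 0 z) ≤ C * oneArmProb d (criticalProbI d) (Site.supNorm z) := by
  have hd1 : 1 ≤ d := le_trans (by norm_num) hd
  have hp : 0 < ((criticalProbI d : unitInterval) : ℝ) := by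
    rw [coe_criticalProbI]; exact criticalProb_zd_pos d hd1
  have hπ : ∀ m : ℕ, 0 < oneArmProb d (criticalProbI d) m := fun m => oneArmProb_pos hd1 _ hp m
  obtain ⟨c, hc, hlow⟩ := exists_le_iicMeasure_real_openConn_all_criticalProbI hd hs hsL hϰ hA2 hl hcU hCU hUAD hν
  obtain ⟨n₀, c', C, hn₀, -, hC, h⟩ := exists_iicMeasure_real_openConn_two_sided_criticalProbI hd hs hsL hϰ hA2 hl hcU hCU hUAD
  -- small sites: `ν(0 ↔ z) ≤ ν(univ) ≤ (ν(univ)/π(n₀) + 1) · π(‖z‖)`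
  set M : ℝ := ν.real Set.univ / oneArmProb d (criticalProbI d) n₀ + 1 with hM
  have hM0 : 0 < M := by
    have : 0 ≤ ν.real Set.univ / oneArmProb d (criticalProbI d) n₀ := div_nonneg measureReal_nonneg (hπ n₀).le
    linarith
  refine ⟨c, max C M, hc, lt_max_of_lt_left hC, fun z => ⟨hlow z, ?_⟩⟩
  by_cases hz : n₀ ≤ Site.supNorm z
  · calc ν.real (openConn 0 z) ≤ C * oneArmProb d (criticalProbI d) (Site.supNorm z) := (h ν hν _ z hz (self_mem_sphere z)).2
      _ ≤ max C M * oneArmProb d (criticalProbI d) (Site.supNorm z) := mul_le_mul_of_nonneg_right (le_max_left _ _) (hπ _).le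
  · have hle : Site.supNorm z ≤ n₀ := by omega
    have hπmono : oneArmProb d (criticalProbI d) n₀ ≤ oneArmProb d (criticalProbI d) (Site.supNorm z) :=
      real_siteToBoundary_antitone (criticalProbI d) hle
    have h1 : ν.real (openConn 0 z) ≤ ν.real Set.univ := measureReal_mono (Set.subset_univ _)
    have h2 : ν.real Set.univ ≤ M * oneArmProb d (criticalProbI d) n₀ := by
      rw [hM, add_mul, div_mul_cancel₀ _ (hπ n₀).ne', one_mul]
      linarith [(hπ n₀).le]
    calc ν.real (openConn 0 z) ≤ M * oneArmProb d (criticalProbI d) n₀ := h1.trans h2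
      _ ≤ M * oneArmProb d (criticalProbI d) (Site.supNorm z) := mul_le_mul_of_nonneg_left hπmono hM0.le
      _ ≤ max C M * oneArmProb d (criticalProbI d) (Site.supNorm z) := mul_le_mul_of_nonneg_right (le_max_right _ _) (hπ _).le

end Summit.CriticalPhenomena.PercolationContinuityZ3.Theorems.Crossing

end
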